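import Summits.HodgeConjecture.CorCM.MultiFieldWeilCurveAbsorption
import HarnessLib

/-!
# MULTI-FIELD WEIL ENGINE — CURVE ABSORPTION FOR SEVERAL SLOTS AT ONCE: a family of CM abelian varieties together with ANY NUMBER of CM elliptic curves, each
# through a member field of odd relative degree, has the Mumford–Tate rank of the family alone (unconditional)

Cell `pub-hodgecm2` (COR-CM), seat b30 gen 34 (2026-08-25); count-neutral own lane MULTI-FIELD WEIL ENGINE (stem `MultiFieldWeil*`), sequel of
`CorCM/MultiFieldWeilCurveAbsorption.lean` (one absorbed slot: `cmFamilyRank_comp_eq_of_absorb`).  Theorems only; no definition, no named fact, no `sorry`.  HONEST FRAMING: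
UNCONDITIONAL statements about `cmFamilyRank` (= `dim MT(∏_i A_i)`); not a step of the summit chain; `HC_CM` is NOT proved and not asserted.

THE STATEMENT (**`cmFamilyRank_comp_eq_of_forall_absorb`**).  `(Φ_i)_{i ∈ I}` CM types of CM fields `K_i`, `ε : J → I` ANY re-indexing such that every slot `i` is either
reached by `ε` or ABSORBED by a reached slot `ε j` (a `ℚ`-linear `L` carrying `𝟙_{τΦ_{ε j}} ↦ 𝟙_{τΦ_i}` for every `τ ∈ Aut(ℂ)`): then `rank(Φ ∘ ε) = rank(Φ)`.  Corollary
(**`cmFamilyRank_comp_eq_of_forall_quadratic_slot_of_odd`**): if every unreached slot is an imaginary quadratic field embedding in a reached member field of ODD relative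
degree, the rank is that of the reached sub-family — `dim MT(∏_i A_i × ∏_a E_a) = dim MT(∏_i A_i)` for CM elliptic curves `E_a` with `k_a ↪ K_{i(a)}`, `[K_{i(a)}:ℚ]/2` odd
(the previous file's `exists_linearMap_translateInd_eq_of_odd` supplies each `L`).  The proof is the one-slot proof run slot by slot: the slot map is injective on the span
of the translates of `𝟙_Σ` because each unreached coordinate block is a fixed linear function of a reached one.  Use: towers of simple CM threefolds each carrying its
absorbed curves (the two-absorbed-blocks theorem `CorCM/MultiFieldWeilTwoSimpleThreefoldsTwoAbsorbedCurves.lean` did this by two successive one-slot absorptions).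

[cite: Deligne1982HodgeCycles, I Ex. 3.7 (c)] [cite: Gordon1999HodgeAVSurvey, 7.4–7.6.1] [cite: MoonenZarhin1999LowDim, Thm. (0.1) (a), §3 (3.1)]

## References
* [Deligne1982HodgeCycles] P. Deligne, *Hodge cycles on abelian varieties*, LNM 900 (1982), I Ex. 3.7.  [Gordon1999HodgeAVSurvey] B. B. Gordon, *A survey of the
  Hodge conjecture for abelian varieties*, 7.4–7.7.  [MoonenZarhin1999LowDim] B. Moonen, Yu. Zarhin, Math. Ann. 315 (1999) 711–733, Thm. (0.1), §3.
-/

noncomputable section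

open NumberField NumberField.ComplexEmbedding

namespace Summit.HodgeConjecture.CorCM.MultiFieldWeil

open Literature.NumberTheory.ComplexMultiplication
open Literature.AlgebraicGeometry.Motives (CMType)
open Literature.AlgebraicGeometry.Pohlmann1968.CMAlgebra

open scoped Classical

/-! ## Several absorbed slots at once -/

section AbsorbAll

variable {I J : Type} {K : I → Type} [∀ i, Field (K i)]

/-- **ABSORPTION OF SEVERAL SLOTS AT ONCE.**  Let `ε : J → I` be ANY re-indexing such that every slot `i` is either reached by `ε` or ABSORBED by a reached slot `ε j`
(a `ℚ`-linear `L : ℚ^{Hom(K_{ε j}, ℂ)} → ℚ^{Hom(K_i, ℂ)}` with `L(𝟙_{τΦ_{ε j}}) = 𝟙_{τΦ_i}` for all `τ ∈ Aut(ℂ)`).  Then `rank(Φ ∘ ε) = rank(Φ)`: e.g. a family of CM threefolds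
each carrying any number of CM elliptic curves through its sextic field has the Mumford–Tate rank of the threefolds alone.  (Same mechanism as `cmFamilyRank_comp_eq_of_absorb`,
slot by slot: the slot map is injective on the span of the translates.) [cite: Deligne1982HodgeCycles, I Ex. 3.7 (c)] [cite: Gordon1999HodgeAVSurvey, 7.4–7.6.1] -/
theorem cmFamilyRank_comp_eq_of_forall_absorb (Φ : ∀ i, CMType (K i)) (ε : J → I)
    (habs : ∀ i, (∃ j, ε j = i) ∨ ∃ j, ∃ L : ((K (ε j) →+* ℂ) → ℚ) →ₗ[ℚ] ((K i →+* ℂ) → ℚ),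
      ∀ τ : ℂ ≃+* ℂ, L (translateInd (Φ (ε j)).1 τ) = translateInd (Φ i).1 τ) :
    cmFamilyRank (fun j => Φ (ε j)) = cmFamilyRank Φ := by
  set f := LinearMap.funLeft ℚ ℚ (fun x : (j : J) × (K (ε j) →+* ℂ) => (⟨ε x.1, x.2⟩ : (i : I) × (K i →+* ℂ))) with hf
  set W := Submodule.span ℚ (Set.range fun τ : ℂ ≃+* ℂ => translateInd (familyType Φ) τ) with hW
  -- the slot map is injective on `W`
  have hinj : ∀ w ∈ W, f w = 0 → w = 0 := by
    intro w hw h0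
    have hR : ∀ j, (LinearMap.funLeft ℚ ℚ fun s => (⟨ε j, s⟩ : (i : I) × (K i →+* ℂ))) w = 0 := fun j => by
      funext s
      have := congrFun h0 ⟨j, s⟩
      rw [hf, LinearMap.funLeft_apply] at this
      rw [LinearMap.funLeft_apply]
      exact this
    funext x
    obtain ⟨i, s⟩ := x
    rcases habs i with ⟨j, rfl⟩ | ⟨j, L, hL⟩
    · have := congrFun (hR j) s
      rw [LinearMap.funLeft_apply] at this
      exact this
    · let R₀ : (((i : I) × (K i →+* ℂ)) → ℚ) →ₗ[ℚ] ((K i →+* ℂ) → ℚ) := LinearMap.funLeft ℚ ℚ fun s => (⟨i, s⟩ : (i : I) × (K i →+* ℂ))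
      let R₁ : (((i : I) × (K i →+* ℂ)) → ℚ) →ₗ[ℚ] ((K (ε j) →+* ℂ) → ℚ) := LinearMap.funLeft ℚ ℚ fun s => (⟨ε j, s⟩ : (i : I) × (K i →+* ℂ))
      have key : W ≤ LinearMap.ker (R₀ - L.comp R₁) := by
        refine Submodule.span_le.2 ?_
        rintro _ ⟨τ, rfl⟩
        have h0' : R₀ (translateInd (familyType Φ) τ) = translateInd (Φ i).1 τ :=
          funext fun s => by rw [LinearMap.funLeft_apply, translateInd_familyType]
        have h1' : R₁ (translateInd (familyType Φ) τ) = translateInd (Φ (ε j)).1 τ :=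
          funext fun s => by rw [LinearMap.funLeft_apply, translateInd_familyType]
        rw [SetLike.mem_coe, LinearMap.mem_ker, LinearMap.sub_apply, LinearMap.comp_apply, h0', h1', hL, sub_self]
      have hk := key hw
      rw [LinearMap.mem_ker, LinearMap.sub_apply, LinearMap.comp_apply, (show R₁ w = 0 from hR j), map_zero, sub_zero] at hk
      have := congrFun hk s
      rw [LinearMap.funLeft_apply] at this
      exact this
  have hker : LinearMap.ker (f.domRestrict W) = ⊥ :=
    LinearMap.ker_eq_bot'.2 fun w h0 => Subtype.ext (hinj w.1 w.2 (by rw [LinearMap.domRestrict_apply] at h0; exact h0))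
  have hrank := LinearMap.finrank_range_of_inj (LinearMap.ker_eq_bot.1 hker)
  rw [LinearMap.range_domRestrict] at hrank
  unfold cmFamilyRank typeRank
  rw [span_translateInd_familyType_comp, ← hW, ← hf]
  exact hrank

/-- **Several CM elliptic curves through member fields of odd relative degree add nothing to the rank**: if every slot off the image of `ε` is quadratic and embeds in a
reached member field `K_{ε j}` with `[K_{ε j} : ℚ]/2` odd, then `rank(Φ ∘ ε) = rank(Φ)`. [cite: MoonenZarhin1999LowDim, Thm. (0.1) (a), §3 (3.1)] [cite: Deligne1982HodgeCycles, I Ex. 3.7 (c)] -/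
theorem cmFamilyRank_comp_eq_of_forall_quadratic_slot_of_odd [∀ i, NumberField (K i)] (Φ : ∀ i, CMType (K i)) (ε : J → I)
    (habs : ∀ i, (∃ j, ε j = i) ∨ (Module.finrank ℚ (K i) = 2 ∧ ∃ j, Nonempty (K i →+* K (ε j)) ∧ ¬ 2 ∣ Module.finrank ℚ (K (ε j)) / 2)) :
    cmFamilyRank (fun j => Φ (ε j)) = cmFamilyRank Φ := by
  refine cmFamilyRank_comp_eq_of_forall_absorb Φ ε fun i => ?_
  rcases habs i with h | ⟨h2, j, ⟨e⟩, hodd⟩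
  · exact Or.inl h
  · obtain ⟨L, hL⟩ := exists_linearMap_translateInd_eq_of_odd (Φ i) h2 e (Φ (ε j)) hodd
    exact Or.inr ⟨j, L, hL⟩

end AbsorbAll

end Summit.HodgeConjecture.CorCM.MultiFieldWeil

end
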